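import Mathlib
import Literature.AlgebraicGeometry.Resolution.CanonicalResolutionProofs
import HarnessLib

/-!
# Separable regular birational local models spread along the stratum, I: generic smoothness

First of three files proving the stub `stub_modelSpreads` of the line
`Cruxes/SepExcModels/Lines/birth.lean` (crux `SharpStrata.SepExcModels`; Benito–Piltant–Reguera
2022, Lemma 4.2 / Prop. 2.1 in valuative dress): a finitely generated birational local model
`B = 𝒪_{Y,w}[s] ⊆ K(Y)` with a prime `𝔮` over `m_w`, `B_𝔮` regular and `(B/𝔮)[1/g]` smooth over
`κ(w)`, spreads to every point of an open neighbourhood of `w` inside `cl{w}`.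

This file contains the commutative algebra that does not mention the scheme (all PROVED):

* transport lemmas: formal smoothness along ring isomorphisms (`formallySmooth_of_ringEquiv`),
  residue fields along maps surjective on stalks (`exists_ringEquiv_residueField`), the residue
  field at a minimal prime of a smooth algebra over a field is formally smooth
  (`formallySmooth_residueField_of_minimalPrimes`: smooth over a field ⇒ regular ⇒ domain, and
  zero-dimensional), `κ(P)` is formally smooth over `A/P`, regularity of local rings is unchanged
  under localisation of the ambient ring;
* `isLocalization_adjoin` — `R[s] ⊆ K` is the localisation of `A[s] ⊆ K` when `R = M⁻¹A ⊆ K`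
  (birational local models are localisations of affine models);
* `exists_open_separable_fibres` — **generic separability spreads over an open of the base**:
  for Noetherian domains `A₀ ⊆ D`, `D` of finite type and smooth over `A₀` at the generic point,
  and an open `O ∋ (0)` of `Spec D`, there is an open `W ∋ (0)` of `Spec A₀` over every point `p`
  of which some prime `Q₀ ∈ O` of `D` lies, with `κ(Q₀)` formally smooth over `A₀/p` (openness
  of the smooth locus, smooth ⇒ flat ⇒ open image by Chevalley + going down, and the minimal
  primes of the smooth fibre `κ(p) ⊗ D[1/h]`).

Design note: to keep elaboration cheap, residue fields are handled through "avatars" (any field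
receiving a map surjective on stalks with the right kernel), and the output of
`exists_open_separable_fibres` packages the fibre ring `D/pD` as an abstract `A₀/p`-algebra `Z`.

## Sources

* A. Benito, O. Piltant, A. J. Reguera, *Small irreducible components of arc spaces in positive
  characteristic*, J. Pure Appl. Algebra 226 (2022) 107113, Lemma 4.2, Prop. 2.1.
  [BenitoPiltantReguera2022]
* The Stacks Project, Tags 00TB/00TA (smooth locus is open), 00TF, 00I1 (flat + finitely
  presented ⇒ open), 07P6 (fields are J-2). [StacksProject]
* U. Görtz, T. Wedhorn, *Algebraic Geometry I*, 2nd ed. (2020), Lemma 6.26. [GortzWedhorn2020]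
-/

noncomputable section

-- single-problem summit: the doubled namespace component `ResolutionOfSingularities` is forced
set_option linter.dupNamespace false

open CategoryTheory AlgebraicGeometry TopologicalSpace Topology
open Literature.AlgebraicGeometry.Resolution

namespace Summit.ResolutionOfSingularities.ResolutionOfSingularities.Theorems.SepExcModels.ModelSpreads

open IsLocalRing

/-! ## Generic transport lemmas -/

/-- Formal smoothness is invariant under ring isomorphisms compatible with the structure maps.
[folklore] -/
theorem formallySmooth_of_ringEquiv {R X Y : Type*} [CommRing R] [CommRing X] [CommRing Y]
    {iX : Algebra R X} {iY : Algebra R Y} (e : X ≃+* Y)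
    (he : ∀ r, e (algebraMap R X r) = algebraMap R Y r) (h : Algebra.FormallySmooth R X) :
    Algebra.FormallySmooth R Y :=
  Algebra.FormallySmooth.of_equiv (AlgEquiv.ofRingEquiv (f := e) he)

/-- **Residue fields along maps surjective on stalks.** If `ψ : C → X` is surjective on stalks
(a composite of localisations and surjections), `X` is a field and `Q = ker ψ`, then the residue
field `κ(Q)` of `C` is isomorphic to `X`, compatibly with `ψ`. [folklore] -/
theorem exists_ringEquiv_residueField {C X : Type*} [CommRing C] [Field X] (ψ : C →+* X)
    (hψ : ψ.SurjectiveOnStalks) (Q : Ideal C) [Q.IsPrime] (hQ : Q = RingHom.ker ψ) :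
    ∃ e : Q.ResidueField ≃+* X, ∀ c : C, e (algebraMap C Q.ResidueField c) = ψ c := by
  have hQ' : Q = (⊥ : Ideal X).comap ψ := hQ
  have hbij := hψ.residueFieldMap_bijective Q (⊥ : Ideal X) hQ'
  let e₁ : Q.ResidueField ≃+* (⊥ : Ideal X).ResidueField := RingEquiv.ofBijective _ hbij
  let e₂ : X ≃ₐ[X] (⊥ : Ideal X).ResidueField := Ideal.algEquivResidueFieldOfField ⊥
  refine ⟨e₁.trans e₂.toRingEquiv.symm, fun c => ?_⟩
  have h1 : e₁ (algebraMap C Q.ResidueField c) = algebraMap X _ (ψ c) :=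
    Ideal.ResidueField.map_algebraMap Q (⊥ : Ideal X) ψ hQ' c
  rw [RingEquiv.trans_apply, h1]
  exact e₂.symm_apply_apply (ψ c)

/-- Composing a map surjective on stalks with a quotient map stays surjective on stalks.
[folklore] -/
theorem surjectiveOnStalks_mk_comp {C D : Type*} [CommRing C] [CommRing D] (f : C →+* D)
    (hf : f.SurjectiveOnStalks) (I : Ideal D) :
    ((Ideal.Quotient.mk I).comp f).SurjectiveOnStalks :=
  (RingHom.surjectiveOnStalks_of_surjective Ideal.Quotient.mk_surjective).comp hf

/-- In a domain, the localisation at a minimal prime `𝔶` whose local ring is a domain is a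
field: its maximal ideal vanishes. [folklore] -/
theorem maximalIdeal_eq_bot_of_minimalPrimes {F : Type*} [CommRing F] (y : Ideal F) [y.IsPrime]
    (hy : y ∈ minimalPrimes F) [IsDomain (Localization.AtPrime y)] :
    maximalIdeal (Localization.AtPrime y) = ⊥ := by
  set L := Localization.AtPrime y
  have hunder : (maximalIdeal L).under F = y := IsLocalization.AtPrime.under_maximalIdeal L y
  have h1 : (⊥ : Ideal L).under F ≤ y :=
    calc (⊥ : Ideal L).under F ≤ (maximalIdeal L).under F := Ideal.comap_mono bot_le
      _ = y := hunder
  have h2 : y ≤ (⊥ : Ideal L).under F := hy.2 ⟨inferInstance, bot_le⟩ h1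
  calc maximalIdeal L = ((maximalIdeal L).under F).map (algebraMap F L) :=
        (IsLocalization.map_under y.primeCompl L _).symm
    _ = ((⊥ : Ideal L).under F).map (algebraMap F L) := by
        rw [hunder]
        exact congrArg (Ideal.map (algebraMap F L)) (le_antisymm h2 h1)
    _ = ⊥ := IsLocalization.map_under y.primeCompl L _

/-- **The residue field at a minimal prime of a smooth algebra over a field is formally smooth**:
the local ring is regular (smooth over a field ⇒ regular, `isRegularLocalRing_of_isSmoothAt`),
hence a domain, and zero-dimensional, hence equal to its residue field.
[cite: GortzWedhorn2020, Lemma 6.26 (p. 196)] -/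
theorem formallySmooth_residueField_of_minimalPrimes {R₀ K₀ F : Type} [CommRing R₀] [Field K₀]
    [CommRing F] [Algebra R₀ K₀] [Algebra K₀ F] [Algebra R₀ F] [IsScalarTower R₀ K₀ F]
    [Algebra.FormallySmooth R₀ K₀] [Algebra.Smooth K₀ F] (y : Ideal F) [y.IsPrime]
    (hy : y ∈ minimalPrimes F) : Algebra.FormallySmooth R₀ y.ResidueField := by
  haveI : Algebra.IsSmoothAt K₀ y := inferInstance
  haveI : IsRegularLocalRing (Localization.AtPrime y) := isRegularLocalRing_of_isSmoothAt K₀ F y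
  haveI : IsDomain (Localization.AtPrime y) := isDomain_of_isRegularLocalRing _
  have hbot := maximalIdeal_eq_bot_of_minimalPrimes y hy
  haveI : Algebra.FormallySmooth K₀ F := Algebra.Smooth.formallySmooth
  haveI : Algebra.FormallySmooth R₀ F := Algebra.FormallySmooth.comp R₀ K₀ F
  haveI : Algebra.FormallySmooth F (Localization.AtPrime y) :=
    Algebra.FormallySmooth.of_isLocalization y.primeCompl
  haveI : Algebra.FormallySmooth R₀ (Localization.AtPrime y) :=
    Algebra.FormallySmooth.comp R₀ F (Localization.AtPrime y)
  have hbij : Function.Bijective (residue (Localization.AtPrime y)) := by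
    refine ⟨?_, residue_surjective⟩
    rw [injective_iff_map_eq_zero]
    intro a ha
    rwa [residue_eq_zero_iff, hbot, Ideal.mem_bot] at ha
  let e : Localization.AtPrime y ≃ₐ[R₀] ResidueField (Localization.AtPrime y) :=
    AlgEquiv.ofBijective (IsScalarTower.toAlgHom R₀ _ _) hbij
  exact Algebra.FormallySmooth.of_equiv e

/-- The residue field of a localisation `R = A_P` is formally smooth over `A/P` (it is its
fraction field). [folklore] -/
theorem formallySmooth_residue_of_isLocalization_atPrime {A R : Type*} [CommRing A] [CommRing R]
    [Algebra A R] (P : Ideal A) [P.IsPrime] [IsLocalRing R] [IsLocalization.AtPrime R P]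
    [Algebra (A ⧸ P) (R ⧸ maximalIdeal R)] [IsScalarTower A (A ⧸ P) (R ⧸ maximalIdeal R)] :
    Algebra.FormallySmooth (A ⧸ P) (R ⧸ maximalIdeal R) := by
  have hI : P.map (algebraMap A R) = maximalIdeal R := IsLocalization.AtPrime.map_eq_maximalIdeal P R
  have h : Algebra.FormallySmooth (A ⧸ P) (R ⧸ P.map (algebraMap A R)) :=
    Algebra.FormallySmooth.of_isLocalization (Algebra.algebraMapSubmonoid (A ⧸ P) P.primeCompl)
  refine formallySmooth_of_ringEquiv (R := A ⧸ P) (Ideal.quotEquivOfEq hI) (fun r => ?_) h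
  obtain ⟨a, rfl⟩ := Ideal.Quotient.mk_surjective r
  rw [Ideal.Quotient.algebraMap_quotient_map_quotient, Ideal.quotEquivOfEq_mk,
    Ideal.Quotient.mk_algebraMap, IsScalarTower.algebraMap_apply A (A ⧸ P) (R ⧸ maximalIdeal R),
    Ideal.Quotient.algebraMap_eq]

/-- For a domain `D`, formal smoothness of the fraction field over a base `R₀` means that `D` is
smooth over `R₀` at the generic point `(0)`. [folklore] -/
theorem isSmoothAt_bot_of_formallySmooth_fractionRing {R₀ D : Type*} [CommRing R₀] [CommRing D]
    [IsDomain D] [Algebra R₀ D] [Algebra.FormallySmooth R₀ (FractionRing D)] :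
    Algebra.IsSmoothAt R₀ (⊥ : Ideal D) := by
  have hM : (⊥ : Ideal D).primeCompl = nonZeroDivisors D := by
    ext x
    simp [Ideal.primeCompl, mem_nonZeroDivisors_iff_ne_zero]
  haveI : IsLocalization (nonZeroDivisors D) (Localization.AtPrime (⊥ : Ideal D)) :=
    hM ▸ (inferInstance : IsLocalization (⊥ : Ideal D).primeCompl (Localization.AtPrime (⊥ : Ideal D)))
  let e : FractionRing D ≃ₐ[D] Localization.AtPrime (⊥ : Ideal D) :=
    IsLocalization.algEquiv (nonZeroDivisors D) _ _
  exact Algebra.FormallySmooth.of_equiv (e.restrictScalars R₀)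

/-- Regularity of the local ring at a prime of a localisation `B = M⁻¹C` is regularity of the
local ring of `C` at the contracted prime (the two local rings are isomorphic). [folklore] -/
theorem isRegularLocalRing_iff_of_isLocalization {C B : Type*} [CommRing C] [CommRing B]
    [Algebra C B] (M : Submonoid C) [IsLocalization M B] (𝔮 : Ideal B) [𝔮.IsPrime]
    (Q : Ideal C) [Q.IsPrime] (hQ : 𝔮.comap (algebraMap C B) = Q) :
    IsRegularLocalRing (Localization.AtPrime 𝔮) ↔ IsRegularLocalRing (Localization.AtPrime Q) := by
  subst hQ
  haveI := IsLocalization.isLocalization_isLocalization_atPrime_isLocalization M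
    (Localization.AtPrime 𝔮) 𝔮
  let e := (IsLocalization.algEquiv (𝔮.comap (algebraMap C B)).primeCompl
    (Localization.AtPrime (𝔮.comap (algebraMap C B))) (Localization.AtPrime 𝔮)).toRingEquiv
  exact ⟨fun _ => IsRegularLocalRing.of_ringEquiv e.symm, fun _ => IsRegularLocalRing.of_ringEquiv e⟩

/-! ## Birational local models inside a field are localisations of affine models -/

/-- **Spreading a local model.** Let `A → R = M⁻¹A → K` be a localisation of `A` inside the
field `K` and `s ⊆ K`. Then `R[s] ⊆ K` is the localisation of `A[s] ⊆ K` at (the image of) `M`,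
for the inclusion `A[s] → R[s]`. [folklore] -/
theorem isLocalization_adjoin {A K R : Type*} [CommRing A] [Field K] [Algebra A K] [CommRing R]
    [Algebra A R] [Algebra R K] [IsScalarTower A R K] (M : Submonoid A) [IsLocalization M R]
    (s : Set K) [Algebra (Algebra.adjoin A s) (Algebra.adjoin R s)]
    (halg : ∀ c : Algebra.adjoin A s,
      (algebraMap (Algebra.adjoin A s) (Algebra.adjoin R s) c : K) = c) :
    IsLocalization (Algebra.algebraMapSubmonoid (Algebra.adjoin A s) M) (Algebra.adjoin R s) := by
  -- every element of `R[s]` is `c / m` with `c ∈ A[s]`, `m ∈ M`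
  have key : ∀ z ∈ Algebra.adjoin R s, ∃ c ∈ Algebra.adjoin A s, ∃ m ∈ M,
      z * algebraMap A K m = c := by
    intro z hz
    refine Algebra.adjoin_induction (fun x hx => ?_) (fun r => ?_) (fun x y _ _ hx hy => ?_)
      (fun x y _ _ hx hy => ?_) hz
    · exact ⟨x, Algebra.subset_adjoin hx, 1, M.one_mem, by simp⟩
    · obtain ⟨⟨a, m⟩, hm⟩ := IsLocalization.surj M r
      refine ⟨algebraMap A K a, Subalgebra.algebraMap_mem _ a, m, m.2, ?_⟩
      rw [IsScalarTower.algebraMap_apply A R K, ← map_mul, hm, ← IsScalarTower.algebraMap_apply]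
    · obtain ⟨c₁, hc₁, m₁, hm₁, h₁⟩ := hx
      obtain ⟨c₂, hc₂, m₂, hm₂, h₂⟩ := hy
      refine ⟨c₁ * algebraMap A K m₂ + c₂ * algebraMap A K m₁,
        Subalgebra.add_mem _ (Subalgebra.mul_mem _ hc₁ (Subalgebra.algebraMap_mem _ m₂))
          (Subalgebra.mul_mem _ hc₂ (Subalgebra.algebraMap_mem _ m₁)), m₁ * m₂, M.mul_mem hm₁ hm₂, ?_⟩
      rw [← h₁, ← h₂, map_mul]
      ring
    · obtain ⟨c₁, hc₁, m₁, hm₁, h₁⟩ := hx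
      obtain ⟨c₂, hc₂, m₂, hm₂, h₂⟩ := hy
      refine ⟨c₁ * c₂, Subalgebra.mul_mem _ hc₁ hc₂, m₁ * m₂, M.mul_mem hm₁ hm₂, ?_⟩
      rw [← h₁, ← h₂, map_mul]
      ring
  have hmapA : ∀ m : A, algebraMap (Algebra.adjoin A s) (Algebra.adjoin R s)
      (algebraMap A (Algebra.adjoin A s) m) = algebraMap R (Algebra.adjoin R s) (algebraMap A R m) := by
    intro m
    apply Subtype.ext
    rw [halg, Subalgebra.coe_algebraMap, Subalgebra.coe_algebraMap,
      ← IsScalarTower.algebraMap_apply]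
  refine ⟨?_, ?_, ?_⟩
  · rintro ⟨_, m, hm, rfl⟩
    rw [hmapA]
    exact (IsLocalization.map_units R ⟨m, hm⟩).map _
  · intro b
    obtain ⟨c, hc, m, hm, h⟩ := key b.1 b.2
    refine ⟨⟨⟨c, hc⟩, ⟨algebraMap A (Algebra.adjoin A s) m, m, hm, rfl⟩⟩, ?_⟩
    apply Subtype.ext
    change (b : K) * (algebraMap (Algebra.adjoin A s) (Algebra.adjoin R s)
      (algebraMap A (Algebra.adjoin A s) m) : K) =
      (algebraMap (Algebra.adjoin A s) (Algebra.adjoin R s) ⟨c, hc⟩ : K)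
    rw [halg, halg, Subalgebra.coe_algebraMap]
    exact h
  · intro x y hxy
    refine ⟨1, ?_⟩
    have : (x : K) = y := by
      have h := congrArg (fun z : Algebra.adjoin R s => (z : K)) hxy
      simpa only [halg] using h
    rw [Subtype.ext this]

/-! ## Generic smoothness spreads over an open of the base -/

/-- **Generic separability spreads over a dense open of the base** (the heart of BPR Lemma 4.2
in scheme-free form). Let `A₀ ⊆ D` be Noetherian domains with `D` of finite type over `A₀`,
`O ⊆ Spec D` an open set containing the generic point, and assume `D` is smooth over `A₀` at
the generic point (i.e. `Frac D` is formally smooth over `A₀`). Then there is an open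
`W ⊆ Spec A₀` containing the generic point such that for every `p ∈ W` some prime `Q₀ ∈ O` of
`D` lies over `p` and has residue field — presented as the residue field of a prime `y` of an
`A₀/p`-algebra `Z` (namely `D/pD`) under a map `D → Z` surjective on stalks — formally smooth
over `A₀/p`:
take `D(h) ∋ (0)` inside `O ∩ smoothLocus`; `D[1/h]` is smooth hence flat over `A₀`, so the
image `W` of `Spec D[1/h]` is open (Chevalley + going down, Stacks 00I1); over `p ∈ W` the
fibre `κ(p) ⊗ D[1/h]` is a non-zero smooth `κ(p)`-algebra, whose localisation at a minimal
prime is regular of dimension zero, i.e. a field, formally smooth over `κ(p)`.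
[cite: StacksProject, Tag 00TF and Tag 00I1] -/
theorem exists_open_separable_fibres {A₀ D : Type} [CommRing A₀] [IsDomain A₀]
    [IsNoetherianRing A₀] [CommRing D] [IsDomain D] [Algebra A₀ D] [Algebra.FiniteType A₀ D]
    (hinj : Function.Injective (algebraMap A₀ D))
    (O : Set (PrimeSpectrum D)) (hO : IsOpen O)
    (hObot : (⟨⊥, Ideal.isPrime_bot⟩ : PrimeSpectrum D) ∈ O)
    (hsm : Algebra.IsSmoothAt A₀ (⊥ : Ideal D)) :
    ∃ W : Set (PrimeSpectrum A₀), IsOpen W ∧ (⟨⊥, Ideal.isPrime_bot⟩ : PrimeSpectrum A₀) ∈ W ∧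
      ∀ p ∈ W, ∃ Q₀ : PrimeSpectrum D, Q₀ ∈ O ∧ Q₀.asIdeal.comap (algebraMap A₀ D) = p.asIdeal ∧
        ∃ (Z : Type) (_ : CommRing Z) (_ : Algebra (A₀ ⧸ p.asIdeal) Z) (y : Ideal Z)
          (_ : y.IsPrime) (φ : D →+* Z), φ.SurjectiveOnStalks ∧ y.comap φ = Q₀.asIdeal ∧
          (∀ a : A₀, φ (algebraMap A₀ D a) =
            algebraMap (A₀ ⧸ p.asIdeal) Z (Ideal.Quotient.mk p.asIdeal a)) ∧
          Algebra.FormallySmooth (A₀ ⧸ p.asIdeal) y.ResidueField := by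
  classical
  haveI : Algebra.FinitePresentation A₀ D := (Algebra.FinitePresentation.of_finiteType).mp ‹_›
  -- a basic open `D(h) ∋ (0)` inside `O ∩ smoothLocus`
  have hmem : (⟨⊥, Ideal.isPrime_bot⟩ : PrimeSpectrum D) ∈ O ∩ Algebra.smoothLocus A₀ D :=
    ⟨hObot, hsm⟩
  obtain ⟨_, ⟨_, ⟨h, rfl⟩, rfl⟩, hbh, hhO⟩ :=
    PrimeSpectrum.isBasis_basic_opens.exists_subset_of_mem_open hmem
      (hO.inter Algebra.isOpen_smoothLocus)
  have hh0 : h ≠ 0 := by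
    intro hh
    apply (PrimeSpectrum.mem_basicOpen h _).mp hbh
    simp [hh]
  -- `D[1/h]` is smooth over `A₀`
  haveI hsmooth : Algebra.Smooth A₀ (Localization.Away h) :=
    Algebra.basicOpen_subset_smoothLocus_iff_smooth.mp (hhO.trans Set.inter_subset_right)
  have hle : Submonoid.powers h ≤ nonZeroDivisors D :=
    powers_le_nonZeroDivisors_of_noZeroDivisors hh0
  -- the image of `Spec D[1/h] → Spec A₀` is open
  have hopen : IsOpenMap (PrimeSpectrum.comap (algebraMap A₀ (Localization.Away h))) :=
    PrimeSpectrum.isOpenMap_comap_of_hasGoingDown_of_finitePresentation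
  refine ⟨Set.range (PrimeSpectrum.comap (algebraMap A₀ (Localization.Away h))),
    hopen.isOpen_range, ?_, ?_⟩
  · -- the generic point is in the image
    haveI : IsDomain (Localization.Away h) := IsLocalization.isDomain_localization hle
    refine ⟨⟨⊥, Ideal.isPrime_bot⟩, ?_⟩
    ext1
    change (⊥ : Ideal (Localization.Away h)).comap (algebraMap A₀ (Localization.Away h)) = ⊥
    refine Ideal.comap_bot_of_injective _ ?_
    rw [IsScalarTower.algebraMap_eq A₀ D (Localization.Away h)]
    exact (IsLocalization.injective (Localization.Away h) hle).comp hinj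
  · rintro p ⟨𝔓, h𝔓⟩
    -- the fibre ring `κ(p) ⊗ D[1/h]` over `p` has a prime (from `𝔓`), hence a minimal prime `𝔶`
    let 𝔓' : PrimeSpectrum (p.asIdeal.Fiber (Localization.Away h)) :=
      PrimeSpectrum.preimageEquivFiber A₀ (Localization.Away h) p ⟨𝔓, h𝔓⟩
    obtain ⟨𝔶, h𝔶min, -⟩ := Ideal.exists_minimalPrimes_le
      (I := (⊥ : Ideal (p.asIdeal.Fiber (Localization.Away h)))) (J := 𝔓'.asIdeal) bot_le
    haveI h𝔶 : 𝔶.IsPrime := h𝔶min.1.1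
    haveI : Algebra.FormallySmooth (A₀ ⧸ p.asIdeal) p.asIdeal.ResidueField :=
      Algebra.FormallySmooth.of_isLocalization (nonZeroDivisors (A₀ ⧸ p.asIdeal))
    have hsm𝔶 := formallySmooth_residueField_of_minimalPrimes (R₀ := A₀ ⧸ p.asIdeal)
      (K₀ := p.asIdeal.ResidueField) 𝔶 h𝔶min
    -- the comparison map `D / pD → κ(p) ⊗ D[1/h]`
    let θ₀ : D →+* p.asIdeal.Fiber (Localization.Away h) :=
      (Algebra.TensorProduct.includeRight (R := A₀) (A := p.asIdeal.ResidueField)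
        (B := Localization.Away h)).toRingHom.comp (algebraMap D (Localization.Away h))
    have hθ₀A : ∀ a : A₀, θ₀ (algebraMap A₀ D a) =
        algebraMap A₀ (p.asIdeal.Fiber (Localization.Away h)) a := by
      intro a
      change Algebra.TensorProduct.includeRight (algebraMap D (Localization.Away h)
        (algebraMap A₀ D a)) = _
      rw [← IsScalarTower.algebraMap_apply, AlgHom.commutes]
    have hpD : ∀ x ∈ p.asIdeal.map (algebraMap A₀ D), θ₀ x = 0 := by
      intro x hx
      have : p.asIdeal.map (algebraMap A₀ D) ≤ RingHom.ker θ₀ := by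
        rw [Ideal.map_le_iff_le_comap]
        intro a ha
        rw [Ideal.mem_comap, RingHom.mem_ker, hθ₀A, IsScalarTower.algebraMap_apply A₀
          p.asIdeal.ResidueField (p.asIdeal.Fiber (Localization.Away h)),
          Ideal.algebraMap_residueField_eq_zero.mpr ha, map_zero]
      exact this hx
    let θ : D ⧸ p.asIdeal.map (algebraMap A₀ D) →+* p.asIdeal.Fiber (Localization.Away h) :=
      Ideal.Quotient.lift _ θ₀ hpD
    have hθmk : θ.comp (Ideal.Quotient.mk _) = θ₀ := RingHom.ext fun x => rfl
    have hθst : θ.SurjectiveOnStalks := by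
      refine RingHom.SurjectiveOnStalks.of_comp (f := Ideal.Quotient.mk _) ?_
      rw [hθmk]
      exact (RingHom.SurjectiveOnStalks.baseChange'
        (p.asIdeal.surjectiveOnStalks_residueField)).comp
        (RingHom.surjectiveOnStalks_of_isLocalization (.powers h) (Localization.Away h))
    let y : PrimeSpectrum (D ⧸ p.asIdeal.map (algebraMap A₀ D)) := ⟨𝔶.comap θ, inferInstance⟩
    have hyO : PrimeSpectrum.comap (Ideal.Quotient.mk _) y ∈ O := by
      have hy : PrimeSpectrum.comap (Ideal.Quotient.mk _) y =
          PrimeSpectrum.comap (algebraMap D (Localization.Away h))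
            (PrimeSpectrum.comap (Algebra.TensorProduct.includeRight (R := A₀)
              (A := p.asIdeal.ResidueField) (B := Localization.Away h)).toRingHom ⟨𝔶, h𝔶⟩) := by
        ext1
        change (𝔶.comap θ).comap (Ideal.Quotient.mk _) = (𝔶.comap _).comap _
        rw [Ideal.comap_comap, Ideal.comap_comap, hθmk]
      rw [hy]
      apply hhO.trans Set.inter_subset_left
      rw [← PrimeSpectrum.localization_away_comap_range (Localization.Away h) h]
      exact ⟨_, rfl⟩
    have hyp : y.asIdeal.comap (algebraMap A₀ _) = p.asIdeal := by
      change (𝔶.comap θ).comap (algebraMap A₀ _) = p.asIdeal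
      rw [Ideal.comap_comap]
      have hcomp : θ.comp (algebraMap A₀ (D ⧸ p.asIdeal.map (algebraMap A₀ D))) =
          algebraMap A₀ (p.asIdeal.Fiber (Localization.Away h)) := by
        ext a
        rw [RingHom.comp_apply, IsScalarTower.algebraMap_apply A₀ D (D ⧸ _),
          Ideal.Quotient.algebraMap_eq, Ideal.Quotient.lift_mk, hθ₀A]
      rw [hcomp]
      exact (𝔶.over_def p.asIdeal).symm
    have hysm : Algebra.FormallySmooth (A₀ ⧸ p.asIdeal) y.asIdeal.ResidueField := by
      have hbij := hθst.residueFieldMap_bijective y.asIdeal 𝔶 rfl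
      let e := RingEquiv.ofBijective _ hbij
      refine formallySmooth_of_ringEquiv (R := A₀ ⧸ p.asIdeal) e.symm (fun r => ?_) hsm𝔶
      obtain ⟨a, rfl⟩ := Ideal.Quotient.mk_surjective r
      apply e.injective
      rw [e.apply_symm_apply]
      dsimp only [e]
      rw [RingEquiv.ofBijective_apply,
        IsScalarTower.algebraMap_apply (A₀ ⧸ p.asIdeal) (D ⧸ p.asIdeal.map (algebraMap A₀ D))
        y.asIdeal.ResidueField, Ideal.ResidueField.map_algebraMap,
        Ideal.Quotient.algebraMap_quotient_map_quotient, Ideal.Quotient.lift_mk, hθ₀A,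
        ← Ideal.Quotient.algebraMap_eq, ← IsScalarTower.algebraMap_apply,
        ← IsScalarTower.algebraMap_apply]
    refine ⟨PrimeSpectrum.comap (Ideal.Quotient.mk _) y, hyO, ?_, D ⧸ p.asIdeal.map (algebraMap A₀ D),
      inferInstance, inferInstance, y.asIdeal, inferInstance, Ideal.Quotient.mk _,
      RingHom.surjectiveOnStalks_of_surjective Ideal.Quotient.mk_surjective, rfl, fun a => rfl, hysm⟩
    rw [PrimeSpectrum.comap_asIdeal, Ideal.comap_comap, ← Ideal.Quotient.algebraMap_eq,
      ← IsScalarTower.algebraMap_eq]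
    exact hyp

end Summit.ResolutionOfSingularities.ResolutionOfSingularities.Theorems.SepExcModels.ModelSpreads

end
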